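import Summits.BirchSwinnertonDyer.BirchSwinnertonDyer.Theses.SignedLowerHalves
import Literature.NumberTheory.EllipticCurves.Rank1Residual.Typed.X6
import Literature.NumberTheory.EllipticCurves.Rank1Residual.Typed.X7
import Literature.NumberTheory.EllipticCurves.Rank1Residual.Typed.X8
import Literature.NumberTheory.EllipticCurves.Isogeny
import Summits.BirchSwinnertonDyer.Rank1Residual.Supersingular.KobayashiMainConjecture
import Summits.BirchSwinnertonDyer.Rank1Residual.Supersingular.KobayashiMainConjectureX7
import Summits.BirchSwinnertonDyer.Rank1Residual.Supersingular.SignedRankOneCorA5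
import Summits.BirchSwinnertonDyer.Rank1Residual.Supersingular.SharpFlatRankZeroReal
import Summits.BirchSwinnertonDyer.Rank1Residual.Partition.MainConjecturesSignedLowerDivisibilityClasses
import Summits.BirchSwinnertonDyer.Rank1Residual.Partition.MainConjecturesCMSupersingular
import HarnessLib


/-!
# BC3 birth skeleton v2 — crux `KobayashiLowerHalfSemistable` (route SignedLowerHalves, rank 2)
Regime split matching the G-ledger of the cell (REPORT-bstw-5/6): p ≥ 5 = BSTW II Thm 1.18's engine (cell audit
PASS-with-cell-repairs, REPORT-bstw-6; engine scope per NOTE-W-ref-2 (α): classes admitting an S2-auxiliary L with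
p ∤ h_L, the p ∣ h_L corner resting on C.2(ii) Rohrlich 1989); p = 3 = the same engine + CHECK(3-ii)(a)(b)(c)
[KLZ17 at 3] + (3-vi) (MEMO-7, unaudited). Stubs are genuine: each is the Eisenstein lower divisibility on a
sub-class of X6.

v2 (planner g10) = the A12 shape `#h21_check_skeleton` accepts: the two stubs are the ONLY sorried declarations and
the composition `KobayashiLowerHalfSemistable_of` concludes the crux BY NAME with NO hypotheses, invoking the stubs
by name (v1 restated the stub statements as ∀-binders of `_of`, which the audit reads as `skeleton.extra-hypothesis`;
a `Stmt.stub_… : Prop` indirection makes the audit register the `Prop`-typed def instead of the stub). Same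
mathematics as v1 (evidence 5eee35cb3b449f3e / tree `Lines/birth.lean` 2026-08-25T22:40Z).
-/

set_option autoImplicit false

namespace Summit.BirchSwinnertonDyer.BirchSwinnertonDyer.Cruxes.KobayashiLowerHalfSemistable


namespace Birth

/-- stub (p ≥ 5): BSTW II Thm 1.18 regime — semistable E, good supersingular p ≥ 5 (a_p = 0 automatic),
conductor of the BSTW shape is implied by `ClassX6` (semistable); engine scope per NOTE-W-ref-2 (α). -/
theorem stub_five_le : ∀ (W : WeierstrassCurve ℚ) [W.IsElliptic] [W.IsGloballyMinimal] (p : ℕ) [Fact p.Prime],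
    p ≠ 2 → Literature.NumberTheory.EllipticCurves.Rank1Residual.ClassX6 W p → 5 ≤ p →
    ∃ ε : ℤˣ, Summit.BirchSwinnertonDyer.Rank1Residual.Supersingular.KobayashiLowerDivisibility W p ε := by
  sorry

/-- stub (p = 3): the same divisibility at p = 3 (a_3 = 0 on X6 at 3); in print PRE + CHECK(3-ii)/(3-vi). -/
theorem stub_three : ∀ (W : WeierstrassCurve ℚ) [W.IsElliptic] [W.IsGloballyMinimal],
    Literature.NumberTheory.EllipticCurves.Rank1Residual.ClassX6 W 3 →
    ∃ ε : ℤˣ, Summit.BirchSwinnertonDyer.Rank1Residual.Supersingular.KobayashiLowerDivisibility W 3 ε := by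
  sorry

/-- composition = THE SKELETON: the crux BY NAME from exactly the two registered stubs (the two regimes exhaust
the odd primes); kernel-checked, no sorry of its own. -/
theorem KobayashiLowerHalfSemistable_of :
    Summit.BirchSwinnertonDyer.BirchSwinnertonDyer.Theses.SignedLowerHalves.KobayashiLowerHalfSemistable := by
  intro W _ _ p hpF hp hX
  by_cases h : 5 ≤ p
  · exact stub_five_le W p hp hX h
  · have h2 := hpF.out.two_le
    have hlt : p < 5 := Nat.lt_of_not_le h
    interval_cases p
    · exact absurd rfl hp
    · exact stub_three W hX
    · exact absurd hpF.out (by decide)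

end Birth

end Summit.BirchSwinnertonDyer.BirchSwinnertonDyer.Cruxes.KobayashiLowerHalfSemistable
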